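import Mathlib
import Summits.NavierStokesRegularity.NavierStokesRegularity.Theorems.SubOnsagerCeilingSideBranchChainDrive
import HarnessLib

/-!
# Route SubOnsagerCeiling — the SIDE MODE of `α_SB` CANNOT PERSIST (it fills its own pocket)
# (helper file for item stmt-NavierStokesRegularity-25507 `OrthantTailCeiling`; `--supports`; def-free)

Brick of the ENGINE for the escape construction behind the negative lemmas of the aside crux
`OrthantTailCeiling` / `ForwardTailCeiling` on the side-branch dead-end table `α_SB`
(`…/Negative/OrthantTailCeilingFalseOfSideBranchCeilingEscape.lean`).  The escape past a bond `k₀` is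
`E₀ − B_{k₀}(T)`; to bound the block energy `B_{k₀}(T)` by the parked pockets one needs the chain and
side modes of the block to RELAX quantitatively, uniformly in small viscosity.  For the side mode this
is self-enforced: a side mode `s_k ≥ σ` fills its pocket at rate `≥ Λ_kσ²/5`, and a filled pocket
drains it.  Three lemmas:

* `sideBranch_decay_upper_bound` — calculus: `s' ≤ β − d'·s` on `[t₀,t₁]`, `d' > 0`
  `⇒ s(t) ≤ s(t₀)e^{−d'(t−t₀)} + (β/d')(1 − e^{−d'(t−t₀)})` (the drive lemma of record applied to
  `s(t₀) − s`);
* `sideBranch_pocket_drive` — the `α_SB` instance of the drive: along a regular `ν`-viscous solution on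
  `[0,s]` (`ν > 0`), if `Λ_k s_k² ≥ 5p` and `z_{k+1} ≥ 0` on `[t₀,t₁] ⊆ [0,s]`, then
  `z_{k+1}(t) ≥ (p/ν_{k+1})(1 − e^{−ν_{k+1}(t−t₀)})` there (`ż_{k+1} = Λ_k s_k²/5 − ν_{k+1}z_{k+1}`);
* `sideBranch_side_drained` — the `α_SB` instance of the decay: if on `[t₀,t₁] ⊆ [0,s]` the feed is
  bounded, `Λ_k x_k² ≤ a`, the side mode is `≥ 0` and the pocket is filled, `z_{k+1} ≥ ζ ≥ 0`, then
  `s_k(t) ≤ s_k(t₀)e^{−d(t−t₀)} + (a/(5d))(1 − e^{−d(t−t₀)})`, `d = Λ_kζ/5 + ν_k`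
  (`ṡ_k = Λ_k(x_k² − s_k z_{k+1})/5 − ν_k s_k`).

Together: a side mode that stays `≥ σ` for a time `Δ` has by then filled its pocket to
`ζ ≍ Λ_kσ²Δ/5`, after which it decays at rate `Λ_kζ/5` towards the level `a/(Λ_kζ)` — so it cannot
stay above `σ` longer than `≍ a/(Λ_k²σ³) + 5 ln(·)/(Λ_kζ)` (assembly left to the user of the bricks).

HONEST FRAMING: elementary real analysis of a Tao-type MODEL lattice ODE (route SubOnsagerCeiling, rung
TL-M2Break); bricks toward a construction that is NOT carried out here; nothing bears on Navier–Stokes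
regularity; no crux is settled here. [cite: Tao2016AveragedNS, §4 (4.2)–(4.3)];
Katz–Pavlović couplings: [cite: BarbatoMorandinRomito2011, §2].
-/

noncomputable section

-- the sub-problem namespace `NavierStokesRegularity.NavierStokesRegularity` is the tree's layout (D-0017)
set_option linter.dupNamespace false

namespace Summit.NavierStokesRegularity.NavierStokesRegularity.Theorems.SubOnsagerCeiling

open Set
open Literature.Analysis.FluidPDE.TaoCascade

/-! ## One piece of calculus on a window `[t₀, t₁]` -/

/-- **Decay against a bounded source.** If `s' = f ≤ β − d'·s` within `[t₀,t₁]` and `d' > 0`, then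
`s(t) ≤ s(t₀)·e^{−d'(t−t₀)} + (β/d')(1 − e^{−d'(t−t₀)})` on `[t₀,t₁]`. [folklore] -/
theorem sideBranch_decay_upper_bound {s f : ℝ → ℝ} {t₀ t₁ β d' : ℝ} (hd' : 0 < d')
    (hs : ∀ u ∈ Icc t₀ t₁, HasDerivWithinAt s (f u) (Icc t₀ t₁) u)
    (hf : ∀ u ∈ Icc t₀ t₁, f u ≤ β - d' * s u) {t : ℝ} (ht : t ∈ Icc t₀ t₁) :
    s t ≤ s t₀ * Real.exp (-(d' * (t - t₀))) + β / d' * (1 - Real.exp (-(d' * (t - t₀)))) := by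
  -- apply the drive lemma to `y = s(t₀) − s`, `y' = −f ≥ (d' s(t₀) − β) − d' y`
  have hy : ∀ u ∈ Icc t₀ t₁, HasDerivWithinAt (fun u => s t₀ - s u) (-f u) (Icc t₀ t₁) u :=
    fun u hu => by simpa using (hs u hu).const_sub (s t₀)
  have hfy : ∀ u ∈ Icc t₀ t₁, (d' * s t₀ - β) - d' * (s t₀ - s u) ≤ -f u := fun u hu => by
    have := hf u hu; linarith
  have hy0 : 0 ≤ s t₀ - s t₀ := by simp
  have h := sideBranch_drive_lower_bound hd' hy hfy hy0 ht
  have hE := Real.exp_pos (-(d' * (t - t₀)))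
  have h1 : (d' * s t₀ - β) / d' = s t₀ - β / d' := by field_simp
  rw [h1] at h
  nlinarith [h, hE]

/-! ## The side mode of `α_SB` fills its pocket and is drained by it -/

section Solution

variable {ε₀ ν s : ℝ} {X : Fin 4 → ℤ → ℝ → ℝ}

/-- **The pocket drive of `α_SB`.** Along a regular solution of the `ν`-viscous `α_SB` lattice on `[0,s]`
(`ν > 0`), let `[t₀,t₁] ⊆ [0,s]` and suppose on `[t₀,t₁]`: `Λ_k s_k² ≥ 5p` (the side mode is on) and
`z_{k+1} ≥ 0`.  Then `z_{k+1}(t) ≥ (p/ν_{k+1})(1 − e^{−ν_{k+1}(t−t₀)})` on `[t₀,t₁]`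
(`Λ_n = (1+ε₀)^{5n/2}`, `ν_n = ν(1+ε₀)^{2n}`; `ż_{k+1} = Λ_k s_k²/5 − ν_{k+1} z_{k+1}`; for
`t − t₀ ≤ 1/ν_{k+1}` the bound is `≥ (1 − e^{-1})·p·(t−t₀)`). [this file] -/
theorem sideBranch_pocket_drive (hε : 0 < ε₀) (hν : 0 < ν)
    (hder : ∀ (i : Fin 4) (k : ℤ), ∀ t ∈ Icc (0 : ℝ) s, HasDerivWithinAt (X i k)
      (quadTerm ε₀ sideBranchTable X i k t - ν * (1 + ε₀) ^ ((2 : ℝ) * k) * X i k t)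
      (Icc (0 : ℝ) s) t)
    (k : ℤ) {t₀ t₁ p : ℝ} (ht₀ : 0 ≤ t₀) (ht₁ : t₁ ≤ s)
    (hsk : ∀ u ∈ Icc t₀ t₁, 5 * p ≤ (1 + ε₀) ^ ((5 : ℝ) * k / 2) * X 1 k u ^ 2)
    (hz0 : ∀ u ∈ Icc t₀ t₁, 0 ≤ X 2 (k + 1) u) {t : ℝ} (ht : t ∈ Icc t₀ t₁) :
    p / (ν * (1 + ε₀) ^ ((2 : ℝ) * ((k + 1 : ℤ) : ℝ))) *
        (1 - Real.exp (-(ν * (1 + ε₀) ^ ((2 : ℝ) * ((k + 1 : ℤ) : ℝ)) * (t - t₀)))) ≤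
      X 2 (k + 1) t := by
  have hb : (0 : ℝ) < 1 + ε₀ := by linarith
  set c₁ : ℝ := ν * (1 + ε₀) ^ ((2 : ℝ) * ((k + 1 : ℤ) : ℝ)) with hc₁
  have hc₁0 : 0 < c₁ := mul_pos hν (Real.rpow_pos_of_pos hb _)
  have hsub : Icc t₀ t₁ ⊆ Icc (0 : ℝ) s := Icc_subset_Icc ht₀ ht₁
  have hy : ∀ u ∈ Icc t₀ t₁, HasDerivWithinAt (X 2 (k + 1))
      (quadTerm ε₀ sideBranchTable X 2 (k + 1) u - c₁ * X 2 (k + 1) u) (Icc t₀ t₁) u :=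
    fun u hu => (hder 2 (k + 1) u (hsub hu)).mono hsub
  have hf : ∀ u ∈ Icc t₀ t₁, p - c₁ * X 2 (k + 1) u ≤
      quadTerm ε₀ sideBranchTable X 2 (k + 1) u - c₁ * X 2 (k + 1) u := by
    intro u hu
    rw [sideBranch_quadTerm_two_succ]
    have := hsk u hu
    linarith
  have hy00 : 0 ≤ X 2 (k + 1) t₀ := hz0 t₀ (left_mem_Icc.2 (ht.1.trans ht.2))
  exact sideBranch_drive_lower_bound hc₁0 hy hf hy00 ht

/-- **The drained side mode of `α_SB`.** Along a regular solution of the `ν`-viscous `α_SB` lattice on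
`[0,s]` (`ν > 0`), let `[t₀,t₁] ⊆ [0,s]` and suppose on `[t₀,t₁]`: the feed is bounded, `Λ_k x_k² ≤ a`,
the side mode is non-negative, `s_k ≥ 0`, and the pocket is filled, `z_{k+1} ≥ ζ` with `ζ ≥ 0`.  Then
`s_k(t) ≤ s_k(t₀)e^{−d(t−t₀)} + (a/(5d))(1 − e^{−d(t−t₀)})` on `[t₀,t₁]` with `d = Λ_kζ/5 + ν_k`
(`ṡ_k = Λ_k(x_k² − s_k z_{k+1})/5 − ν_k s_k`). [this file] -/
theorem sideBranch_side_drained (hε : 0 < ε₀) (hν : 0 < ν)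
    (hder : ∀ (i : Fin 4) (k : ℤ), ∀ t ∈ Icc (0 : ℝ) s, HasDerivWithinAt (X i k)
      (quadTerm ε₀ sideBranchTable X i k t - ν * (1 + ε₀) ^ ((2 : ℝ) * k) * X i k t)
      (Icc (0 : ℝ) s) t)
    (k : ℤ) {t₀ t₁ a ζ : ℝ} (ht₀ : 0 ≤ t₀) (ht₁ : t₁ ≤ s) (hζ : 0 ≤ ζ)
    (hxa : ∀ u ∈ Icc t₀ t₁, (1 + ε₀) ^ ((5 : ℝ) * k / 2) * X 0 k u ^ 2 ≤ a)
    (hsk : ∀ u ∈ Icc t₀ t₁, 0 ≤ X 1 k u)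
    (hz : ∀ u ∈ Icc t₀ t₁, ζ ≤ X 2 (k + 1) u) {t : ℝ} (ht : t ∈ Icc t₀ t₁) :
    X 1 k t ≤ X 1 k t₀ * Real.exp (-(((1 / 5 : ℝ) * (1 + ε₀) ^ ((5 : ℝ) * k / 2) * ζ +
        ν * (1 + ε₀) ^ ((2 : ℝ) * k)) * (t - t₀))) +
      a / (5 * ((1 / 5 : ℝ) * (1 + ε₀) ^ ((5 : ℝ) * k / 2) * ζ + ν * (1 + ε₀) ^ ((2 : ℝ) * k))) *
        (1 - Real.exp (-(((1 / 5 : ℝ) * (1 + ε₀) ^ ((5 : ℝ) * k / 2) * ζ +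
          ν * (1 + ε₀) ^ ((2 : ℝ) * k)) * (t - t₀)))) := by
  have hb : (0 : ℝ) < 1 + ε₀ := by linarith
  set Λ : ℝ := (1 + ε₀) ^ ((5 : ℝ) * k / 2) with hΛ
  set c₀ : ℝ := ν * (1 + ε₀) ^ ((2 : ℝ) * k) with hc₀
  have hΛ0 : 0 < Λ := Real.rpow_pos_of_pos hb _
  have hc₀0 : 0 < c₀ := mul_pos hν (Real.rpow_pos_of_pos hb _)
  set d : ℝ := (1 / 5 : ℝ) * Λ * ζ + c₀ with hd
  have hd0 : 0 < d := by
    have : 0 ≤ (1 / 5 : ℝ) * Λ * ζ := by positivity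
    rw [hd]; linarith
  have hsub : Icc t₀ t₁ ⊆ Icc (0 : ℝ) s := Icc_subset_Icc ht₀ ht₁
  have hs' : ∀ u ∈ Icc t₀ t₁, HasDerivWithinAt (X 1 k)
      (quadTerm ε₀ sideBranchTable X 1 k u - c₀ * X 1 k u) (Icc t₀ t₁) u :=
    fun u hu => (hder 1 k u (hsub hu)).mono hsub
  have hf : ∀ u ∈ Icc t₀ t₁, quadTerm ε₀ sideBranchTable X 1 k u - c₀ * X 1 k u ≤
      a / 5 - d * X 1 k u := by
    intro u hu
    rw [sideBranch_quadTerm_one, ← hΛ]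
    have h1 : X 1 k u * ζ ≤ X 1 k u * X 2 (k + 1) u := mul_le_mul_of_nonneg_left (hz u hu) (hsk u hu)
    have h2 : (1 / 5 : ℝ) * Λ * (X 1 k u * ζ) ≤ (1 / 5 : ℝ) * Λ * (X 1 k u * X 2 (k + 1) u) :=
      mul_le_mul_of_nonneg_left h1 (by positivity)
    have h3 : d * X 1 k u = (1 / 5 : ℝ) * Λ * (X 1 k u * ζ) + c₀ * X 1 k u := by rw [hd]; ring
    have h4 := hxa u hu
    have h5 : (1 / 5 : ℝ) * Λ * X 0 k u ^ 2 ≤ a / 5 := by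
      rw [hΛ]; linarith
    linarith
  have h := sideBranch_decay_upper_bound hd0 hs' hf ht
  have h6 : a / 5 / d = a / (5 * d) := by rw [div_div]
  rw [h6] at h
  simpa only [hd, hΛ, hc₀] using h

end Solution

end Summit.NavierStokesRegularity.NavierStokesRegularity.Theorems.SubOnsagerCeiling

end
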